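import Literature.NumberTheory.GaloisRepresentations.EisensteinSexticHeckeCharacterOdd
import Literature.NumberTheory.EllipticCurves.SexticTwistGrossencharakterFrobenius
import HarnessLib

/-!
# Frobenius values (including `p = 2`), ramification at `λ`, and the Deuring datum for the good-at-`2` sextic twists
# `E^{16u} : y² = x³ + 16u`, `u ≡ 1 (mod 4)` (Ireland–Rosen Ch. 18 Theorems 4, 5, 7)

Topic `Literature/NumberTheory/EllipticCurves`, namespace `Literature.NumberTheory.EllipticCurves.SexticTwist` (sequel of
`SexticTwistGrossencharakterFrobenius`, on the character `EisensteinSextic.psiOdd` modulo `(9u)` of `GaloisRepresentations/EisensteinSexticHeckeCharacterOdd`).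
THEOREMS only (no definition, no instance, no named fact).  For `k = 16u`, `u ≡ 1 (mod 4)`, the curve `E^k` has good supersingular reduction at `2`
(`y² + y = x³ + (u − 1)/4`; `SexticTwist.lFunction_apply_two_of_eq_sixteen_mul`), and `(16u/p) = (p/|u|)`, `(64u/𝔭)₃ = (u/𝔭)₃`:

* §1 `legendreSym_eq_jacobiSym_natAbs` (`(u/p) = (p/|u|)` for `u ≡ 1 (4)`, quadratic reciprocity), `legendreSym_sixteen_mul`; ★★ `psiOdd_frobenius` —
  for EVERY prime `p ∤ 3u` (so also `p = 2`) and `𝔭_v ∋ p`: `(9u) ∤ 𝔭_v`; split: `ψ'(v) + ψ'(c•v) = a_p(E^{16u})`, `ψ'(v) ψ'(c•v) = p`; inert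
  (including `(2)`): `a_p = 0`, `ψ'(v) = −p`;
* §2 (universe `Type`) `idealPow_psiOdd_span_intCast_ne`, ★★ `not_isUnramifiedAt_heckeOfGross_psiOdd_three` (ramified at `λ`, witness `a = 1 + 4m²`),
  ★★★ `exists_isGrossencharakter_datum_goodTwo` (the packaged datum with `¬ (p:ℤ) ∣ 3u`, in the shape of the BED route's `core_of_datum(_set)`),
  `exists_heckeCharacter_psiOdd` (clauses (i), (ii), (iv) of `Deuring_exists_heckeCharacter_of_maximalCM` on the good-at-`2` class).

What is NOT here: the ramification witnesses at the odd primes of `u` (the FILE C lane of the `bsd-wall` cell, same method with `D = u`).  Nothing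
about BSD is proved here; no modularity is used.

## References
* K. Ireland, M. Rosen, *A Classical Introduction to Modern Number Theory*, 2nd ed., GTM 84 (1990), Ch. 5 §§1–2 (quadratic reciprocity); Ch. 18 §3
  Theorem 4, §4 Theorem 5, §6 Theorem 7, §7. [IrelandRosen1990]
* J. H. Silverman, *Advanced Topics in the Arithmetic of Elliptic Curves* (1994), II Thm. 9.2, Thm. 10.5. [SilvermanATAEC1994]
* J. Neukirch, *Algebraic Number Theory* (1999), Ch. VII §6 Cor. (6.14). [NeukirchANT1999]

## Mathlib / tree search
Tree: `EisensteinSextic.{psiOdd, modulusOdd, modulusOdd_le_iff, modulusOdd_ne_bot, psiOdd_of_not_mem, psiOdd_smul_eq_conj, isGrossencharakter_psiOdd_one_zero,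
idealPow_psiOdd_span, not_mem_of_three_mul_not_mem, cubicLoc, coe_cubicLoc_of_not_mem, cubicLoc_pow_three, artinSymbol_cubicLoc_pow_three, varpi, span_varpi,
varpi_sub_one_mem, varpi_eq_of, hsurj_three, hinj_three, intCast_mem_smul_iff, subsingleton_infinitePlace, residueCard_eq_of_mod_three_eq_one,
asIdeal_eq_span_of_mod_three_eq_two, smul_eq_self_of_mod_three_eq_two, smul_ne_self_of_mod_three_eq_one, eq_of_three_mem, absNorm_span_intCast,
not_mem_of_six_mul_not_mem}`; `SexticTwist.{lFunction_apply_prime_split, lFunction_apply_two_of_eq_sixteen_mul, six_mul_not_mem_of_natCast_mem}`,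
`lFunction_mordellCurve_apply_prime_eq_zero`, `cubicResidueSymbol_natCast_eq_one_of_residueCard_eq_sq`, `cubicResidueSymbol_{mul,spec,one}`,
`not_isUnramifiedAt_heckeOfGross_of_ne`, `heckeOfGross*`, `modulusExp`, `pow_modulusExp_dvd`.  Mathlib: `jacobiSym.{quadratic_reciprocity_one_mod_four,
quadratic_reciprocity_three_mod_four, neg, sq_one, sq_one', legendreSym.to_jacobiSym}`, `ZMod.χ₄_nat_one_mod_four/three_mod_four`, `legendreSym.{mul, sq_one'}`,
`Nat.exists_eq_pow_mul_and_not_dvd`, `Fintype.prod_subsingleton`.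
-/

noncomputable section

open NumberField IsDedekindDomain IsDedekindDomain.HeightOneSpectrum
open scoped NumberTheorySymbols ComplexConjugate Pointwise

namespace Literature.NumberTheory.EllipticCurves.SexticTwist

open Literature.NumberTheory.GaloisRepresentations Literature.NumberTheory.GaloisRepresentations.EisensteinSextic
open Literature.NumberTheory.LFunctions (idealPow isCoprime_span_of_sub_mem)
open Literature.NumberTheory.LFunctions.AbelianDensity (artinSymbol artinSymbol_asIdeal idealPow_comp_eq)
open Literature.NumberTheory.Automorphic (RingOfIntegers.coe_algEquiv_smul HeightOneSpectrum.smul_mem_smul_asIdeal_iff)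
open WeierstrassCurve

/-! ### §D1 Quadratic reciprocity for `u ≡ 1 (mod 4)`: `(u/p) = (p/|u|)`; Frobenius matching for `E^{16u}` including `p = 2` -/

section FrobeniusOdd

variable {K : Type*} [Field K] [NumberField K] {ζ : 𝓞 K} (hζ : IsPrimitiveRoot ζ 3)

omit [NumberField K] in
/-- **`(u/p) = (p/|u|)` for `u ≡ 1 (mod 4)` and an odd prime `p`** (quadratic reciprocity; for `u < 0`, `|u| ≡ 3 (4)` and the sign of `(−1/p)`
cancels). [cite: IrelandRosen1990, Ch. 5 §2 Theorem 1 (quadratic reciprocity) and Prop. 5.1.2] -/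
theorem legendreSym_eq_jacobiSym_natAbs {u : ℤ} (hu4 : u % 4 = 1) {p : ℕ} [Fact p.Prime] (hp2 : p ≠ 2) :
    legendreSym p u = J((p : ℤ) | u.natAbs) := by
  have hp : p.Prime := Fact.out
  have hpodd : Odd p := hp.odd_of_ne_two hp2
  rw [jacobiSym.legendreSym.to_jacobiSym]
  rcases Int.natAbs_eq u with h | h
  · -- `u = |u| ≡ 1 (4)`
    have hn : u.natAbs % 4 = 1 := by omega
    conv_lhs => rw [h]
    exact jacobiSym.quadratic_reciprocity_one_mod_four hn hpodd
  · -- `u = −|u|`, `|u| ≡ 3 (4)`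
    have hn : u.natAbs % 4 = 3 := by omega
    conv_lhs => rw [h]
    rw [jacobiSym.neg _ hpodd]
    have hp4 : p % 4 = 1 ∨ p % 4 = 3 := by have := Nat.odd_iff.mp hpodd; omega
    rcases hp4 with h1 | h3
    · rw [ZMod.χ₄_nat_one_mod_four h1, one_mul]
      exact (jacobiSym.quadratic_reciprocity_one_mod_four h1 (Nat.odd_iff.mpr (by omega))).symm
    · rw [ZMod.χ₄_nat_three_mod_four h3, jacobiSym.quadratic_reciprocity_three_mod_four hn h3]; ring

omit [NumberField K] in
/-- `(16u/p) = (u/p)` for an odd prime `p`. [cite: IrelandRosen1990, Ch. 5 §1 Prop. 5.1.2] -/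
theorem legendreSym_sixteen_mul {u : ℤ} {p : ℕ} [Fact p.Prime] (hp2 : p ≠ 2) : legendreSym p (16 * u) = legendreSym p u := by
  have hp : p.Prime := Fact.out
  have h4 : ((4 : ℤ) : ZMod p) ≠ 0 := by
    intro h
    have hdvd : (p : ℤ) ∣ 4 := (ZMod.intCast_zmod_eq_zero_iff_dvd 4 p).mp h
    have : p ∣ 2 ^ 2 := by exact_mod_cast hdvd
    exact hp2 ((Nat.prime_dvd_prime_iff_eq hp Nat.prime_two).mp (hp.dvd_of_dvd_pow this))
  rw [legendreSym.mul, show (16 : ℤ) = 4 ^ 2 by norm_num, legendreSym.sq_one' p h4, one_mul]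

omit [NumberField K] in
/-- `3u ∉ 𝔭` for `𝔭 ∋ p`, `p ∤ 3u`. [cite: IrelandRosen1990, Ch. 18 §7] -/
theorem three_mul_not_mem_of_natCast_mem {u : ℤ} {p : ℕ} (hp : p.Prime) (hpu : ¬ (p : ℤ) ∣ 3 * u) {v : HeightOneSpectrum (𝓞 K)}
    (hv : (p : 𝓞 K) ∈ v.asIdeal) : ((3 * u : ℤ) : 𝓞 K) ∉ v.asIdeal := by
  intro h3
  obtain ⟨a, b, hab⟩ := (Nat.prime_iff_prime_int.mp hp).coprime_iff_not_dvd.mpr hpu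
  have h1 : (1 : 𝓞 K) = (a : 𝓞 K) * (p : 𝓞 K) + (b : 𝓞 K) * ((3 * u : ℤ) : 𝓞 K) := by exact_mod_cast congrArg (Int.cast (R := 𝓞 K)) hab.symm
  exact v.isPrime.ne_top ((Ideal.eq_top_iff_one _).mpr (h1 ▸ v.asIdeal.add_mem (v.asIdeal.mul_mem_left _ hv) (v.asIdeal.mul_mem_left _ h3)))

omit [NumberField K] in
/-- `d ≡ n (mod 𝔭)` for a natural number `n` prime to `p` (`𝔭 ∋ p ∤ d`). [folklore] -/
private theorem exists_nat_mk_intCast_eq {d : ℤ} {p : ℕ} (hp : p.Prime) (hpd : ¬ (p : ℤ) ∣ d) {v : HeightOneSpectrum (𝓞 K)}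
    (hv : (p : 𝓞 K) ∈ v.asIdeal) : ∃ n : ℕ, ¬ p ∣ n ∧ Ideal.Quotient.mk v.asIdeal ((d : ℤ) : 𝓞 K) = (n : 𝓞 K ⧸ v.asIdeal) := by
  have hp0 : (p : ℤ) ≠ 0 := by exact_mod_cast hp.ne_zero
  set r : ℤ := d % p with hr
  have hr0 : 0 ≤ r := Int.emod_nonneg _ hp0
  refine ⟨r.toNat, fun hd => ?_, ?_⟩
  · have hd' : (p : ℤ) ∣ r := by rw [← Int.toNat_of_nonneg hr0]; exact_mod_cast hd
    have h := dvd_add (Int.dvd_self_sub_emod (x := d) (m := (p : ℤ))) hd'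
    rw [hr, sub_add_cancel] at h
    exact hpd h
  · have hcast : ((r.toNat : ℕ) : 𝓞 K ⧸ v.asIdeal) = Ideal.Quotient.mk v.asIdeal ((r : ℤ) : 𝓞 K) := by
      rw [map_intCast, ← Int.toNat_of_nonneg hr0]; push_cast; rw [Int.toNat_of_nonneg hr0]
    rw [hcast, Ideal.Quotient.eq]
    obtain ⟨q, hq⟩ := Int.dvd_self_sub_emod (x := d) (m := (p : ℤ))
    rw [← hr] at hq
    have e : ((d : ℤ) : 𝓞 K) - ((r : ℤ) : 𝓞 K) = (q : 𝓞 K) * (p : 𝓞 K) := by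
      have h' : ((d : ℤ) : 𝓞 K) - ((r : ℤ) : 𝓞 K) = ((d - r : ℤ) : 𝓞 K) := by push_cast; ring
      rw [h', hq]; push_cast; ring
    rw [e]; exact v.asIdeal.mul_mem_left _ hv

variable [IsCyclotomicExtension {3} ℚ K]

/-- ★★ **Frobenius matching for `E^{16u} : y² = x³ + 16u`, `u ≡ 1 (mod 4)`**, at EVERY prime `p ∤ 3u` (so also at `p = 2`, where `E^{16u}` has
good supersingular reduction): `(9u) ∤ 𝔭_v`; SPLIT (`c • v ≠ v`): `ψ'(v) + ψ'(c • v) = a_p`, `ψ'(v) ψ'(c • v) = p`; INERT (`c • v = v`, `p ≡ 2 (3)`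
or `p = 2`): `a_p = 0` and `ψ'(v) = −p`. [cite: IrelandRosen1990, Ch. 18 §3 Theorem 4, §4 Theorem 5, §7] [cite: SilvermanATAEC1994, II Thm. 10.5 (b)] -/
theorem psiOdd_frobenius {u : ℤ} (hu4 : u % 4 = 1) (e : K →+* ℂ) {c : K ≃ₐ[ℚ] K} (hc : c ≠ 1) {p : ℕ} (hp : p.Prime)
    (hpu : ¬ (p : ℤ) ∣ 3 * u) {v : HeightOneSpectrum (𝓞 K)} (hv : (p : 𝓞 K) ∈ v.asIdeal) :
    ¬ modulusOdd u ≤ v.asIdeal ∧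
    (c • v ≠ v → psiOdd hζ u e v + psiOdd hζ u e (c • v) = ((mordellCurve ((16 * u : ℤ) : ℚ)).LFunction p : ℂ) ∧
      psiOdd hζ u e v * psiOdd hζ u e (c • v) = p) ∧
    (c • v = v → (mordellCurve ((16 * u : ℤ) : ℚ)).LFunction p = 0 ∧ psiOdd hζ u e v = -(p : ℂ)) := by
  have h3u := three_mul_not_mem_of_natCast_mem hp hpu hv
  obtain ⟨h3v, huv⟩ := not_mem_of_three_mul_not_mem h3u
  have hpu' : ¬ (p : ℤ) ∣ u := fun h => hpu (dvd_mul_of_dvd_right h 3)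
  have hp3 : p ≠ 3 := by rintro rfl; exact hpu (dvd_mul_right 3 u)
  have huodd : ¬ (2 : ℤ) ∣ u := by omega
  have hgcd : ∀ {q : ℕ}, q.Prime → ¬ (q : ℤ) ∣ u → (q : ℤ).gcd (u.natAbs : ℤ) = 1 := fun {q} hq hqu => by
    rw [Int.gcd_natCast_natCast]
    exact (Nat.Prime.coprime_iff_not_dvd hq).mpr fun hd => hqu (Int.natCast_dvd.mpr hd)
  refine ⟨(modulusOdd_le_iff u v).not.mpr h3u, ?_⟩
  rcases eq_or_ne p 2 with rfl | hp2
  · -- `p = 2`: `𝔭 = (2)` is inert, `a_2(E^{16u}) = 0`, `ψ'((2)) = −2`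
    have hv2 : v.asIdeal = Ideal.span {((2 : ℕ) : 𝓞 K)} := asIdeal_eq_span_of_mod_three_eq_two Nat.prime_two (by norm_num) hv
    have hcv : c • v = v := smul_eq_self_of_mod_three_eq_two c Nat.prime_two (by norm_num) hv
    refine ⟨fun hne => absurd hcv hne, fun _ => ⟨?_, ?_⟩⟩
    · exact_mod_cast lFunction_apply_two_of_eq_sixteen_mul (k := 16 * u) hu4 rfl
    · have hN : Ideal.absNorm v.asIdeal = 2 ^ 2 := by rw [hv2, EisensteinCubic.absNorm_span_natCast']
      have hJ : J((Ideal.absNorm v.asIdeal : ℤ) | u.natAbs) = 1 := by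
        rw [hN, Nat.cast_pow, jacobiSym.sq_one' (hgcd Nat.prime_two huodd)]
      have hC : (cubicLoc hζ ((u : ℤ) : 𝓞 K) e v : ℂ) = 1 := by
        rw [coe_cubicLoc_of_not_mem hζ e huv h3v]
        have h1 : Ideal.Quotient.mk v.asIdeal ((u : ℤ) : 𝓞 K) = Ideal.Quotient.mk v.asIdeal 1 := by
          rw [Ideal.Quotient.eq, hv2, Ideal.mem_span_singleton]
          obtain ⟨j, hj⟩ : ∃ j : ℤ, u = 2 * j + 1 := ⟨u / 2, by omega⟩
          exact ⟨(j : 𝓞 K), by rw [hj]; push_cast; ring⟩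
        rw [h1, map_one, cubicResidueSymbol_one hζ h3v]; simp
      have hϖ : varpi hζ v = -(2 : 𝓞 K) := by
        refine varpi_eq_of hζ h3v (by rw [Ideal.span_singleton_neg, hv2, Nat.cast_ofNat]) ?_
        exact Ideal.mem_span_singleton'.mpr ⟨-1, by ring⟩
      have heϖ : e (varpi hζ v : K) = -(2 : ℂ) := by
        rw [hϖ, show (-(2 : 𝓞 K) : 𝓞 K) = ((-2 : ℤ) : 𝓞 K) by norm_num,
          show (((-2 : ℤ) : 𝓞 K) : K) = ((-2 : ℤ) : K) from map_intCast (algebraMap (𝓞 K) K) (-2), map_intCast]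
        norm_num
      rw [psiOdd_of_not_mem hζ e h3u, hJ, hC, heϖ, Int.cast_one, one_mul, one_mul]
      norm_num
  · -- `p` odd, `p ∤ 6 · 16u`
    have hp6 : ¬ (p : ℤ) ∣ 6 * (16 * u) := by
      rw [show (6 : ℤ) * (16 * u) = 2 ^ 5 * (3 * u) by ring]
      intro h
      rcases (Nat.prime_iff_prime_int.mp hp).dvd_or_dvd h with h32 | h3
      · have : p ∣ 2 ^ 5 := by exact_mod_cast h32
        exact hp2 ((Nat.prime_dvd_prime_iff_eq hp Nat.prime_two).mp (hp.dvd_of_dvd_pow this))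
      · exact hpu h3
    have hpk16 : ¬ (p : ℤ) ∣ 16 * u := fun h => hp6 (dvd_mul_of_dvd_right h 6)
    obtain ⟨h2v, -, -⟩ := not_mem_of_six_mul_not_mem (six_mul_not_mem_of_natCast_mem hp hp6 hv)
    haveI := Fact.mk hp
    have hmod3 : p % 3 ≠ 0 := fun h0 => hp3 ((Nat.prime_dvd_prime_iff_eq Nat.prime_three hp).mp (Nat.dvd_of_mod_eq_zero h0)).symm
    constructor
    · -- split
      intro hne
      have hp1 : p % 3 = 1 := by
        by_contra h1
        exact hne (smul_eq_self_of_mod_three_eq_two c hp (by omega) hv)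
      have hN := residueCard_eq_of_mod_three_eq_one hp hp1 hv
      obtain ⟨hap, hϖϖ⟩ := lFunction_apply_prime_split hζ (k := 16 * u) hp1 hpk16 e hv hN (span_varpi hζ h3v)
        (varpi_sub_one_mem hζ h3v)
      -- `(64u/𝔭)₃ = (u/𝔭)₃`
      have h4 : (Ideal.Quotient.mk v.asIdeal (4 : 𝓞 K)) ≠ 0 := by
        intro h0
        rw [Ideal.Quotient.eq_zero_iff_mem, show (4 : 𝓞 K) = 2 * 2 by norm_num] at h0
        rcases v.isPrime.mem_or_mem h0 with h | h <;> exact h2v h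
      have hχ : cubicResidueSymbol v (Ideal.Quotient.mk v.asIdeal ((4 * (16 * u) : ℤ) : 𝓞 K)) =
          cubicResidueSymbol v (Ideal.Quotient.mk v.asIdeal ((u : ℤ) : 𝓞 K)) := by
        have e64 : ((4 * (16 * u) : ℤ) : 𝓞 K) = 4 * (4 * (4 * ((u : ℤ) : 𝓞 K))) := by push_cast; ring
        rw [e64, map_mul, map_mul, map_mul, cubicResidueSymbol_mul hζ, cubicResidueSymbol_mul hζ, cubicResidueSymbol_mul hζ,
          show ∀ x y : 𝓞 K, x * (x * (x * y)) = x ^ 3 * y from fun x y => by ring, (cubicResidueSymbol_spec hζ h3v h4).1, one_mul]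
      have hz : psiOdd hζ u e v = (legendreSym p (16 * u) : ℂ) *
          e (cubicResidueSymbol v (Ideal.Quotient.mk v.asIdeal ((4 * (16 * u) : ℤ) : 𝓞 K)) : K) * e (varpi hζ v : K) := by
        rw [psiOdd_of_not_mem hζ e h3u, coe_cubicLoc_of_not_mem hζ e huv h3v, show Ideal.absNorm v.asIdeal = p from hN,
          legendreSym_sixteen_mul hp2, legendreSym_eq_jacobiSym_natAbs hu4 hp2, hχ]
      have hcz : psiOdd hζ u e (c • v) = conj (psiOdd hζ u e v) := psiOdd_smul_eq_conj hζ e hc v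
      refine ⟨by rw [hcz, hz]; exact hap.symm, ?_⟩
      rw [hcz, psiOdd_of_not_mem hζ e h3u, map_mul, map_mul, map_intCast]
      have hJ : (J((Ideal.absNorm v.asIdeal : ℤ) | u.natAbs) : ℂ) * (J((Ideal.absNorm v.asIdeal : ℤ) | u.natAbs) : ℂ) = 1 := by
        rw [← Int.cast_mul, ← sq, show Ideal.absNorm v.asIdeal = p from hN, jacobiSym.sq_one (hgcd hp hpu'), Int.cast_one]
      have hC : (cubicLoc hζ ((u : ℤ) : 𝓞 K) e v : ℂ) * conj (cubicLoc hζ ((u : ℤ) : 𝓞 K) e v : ℂ) = 1 := by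
        set w := cubicLoc hζ ((u : ℤ) : 𝓞 K) e v
        have h3 : (w : ℂ) ^ 3 = 1 := by rw [← Units.val_pow_eq_pow_val, cubicLoc_pow_three, Units.val_one]
        have hn : ‖(w : ℂ)‖ = 1 := by
          have h' : ‖(w : ℂ)‖ ^ 3 = 1 := by rw [← norm_pow, h3, norm_one]
          exact (pow_eq_one_iff_of_nonneg (norm_nonneg _) (by norm_num)).mp h'
        rw [Complex.mul_conj, Complex.normSq_eq_norm_sq, hn]; norm_num
      calc (J((Ideal.absNorm v.asIdeal : ℤ) | u.natAbs) : ℂ) * (cubicLoc hζ ((u : ℤ) : 𝓞 K) e v : ℂ) * e (varpi hζ v : K) *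
            ((J((Ideal.absNorm v.asIdeal : ℤ) | u.natAbs) : ℂ) * conj (cubicLoc hζ ((u : ℤ) : 𝓞 K) e v : ℂ) * conj (e (varpi hζ v : K)))
          = ((J((Ideal.absNorm v.asIdeal : ℤ) | u.natAbs) : ℂ) * (J((Ideal.absNorm v.asIdeal : ℤ) | u.natAbs) : ℂ)) *
            ((cubicLoc hζ ((u : ℤ) : 𝓞 K) e v : ℂ) * conj (cubicLoc hζ ((u : ℤ) : 𝓞 K) e v : ℂ)) *
            (e (varpi hζ v : K) * conj (e (varpi hζ v : K))) := by ring
        _ = p := by rw [hJ, hC, hϖϖ, one_mul, one_mul]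
    · -- inert
      intro hcv
      have hp23 : p % 3 = 2 := by
        by_contra h2
        exact smul_ne_self_of_mod_three_eq_one hζ hc hp (by omega) hv hcv
      refine ⟨lFunction_mordellCurve_apply_prime_eq_zero hp hp23 hp2 hpk16, ?_⟩
      have hvp := asIdeal_eq_span_of_mod_three_eq_two hp hp23 hv
      have hN : v.residueCard = p ^ 2 := by
        show Ideal.absNorm v.asIdeal = p ^ 2; rw [hvp, EisensteinCubic.absNorm_span_natCast']
      have hJ : J((Ideal.absNorm v.asIdeal : ℤ) | u.natAbs) = 1 := by
        rw [show Ideal.absNorm v.asIdeal = p ^ 2 from hN, Nat.cast_pow, jacobiSym.sq_one' (hgcd hp hpu')]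
      have hC : (cubicLoc hζ ((u : ℤ) : 𝓞 K) e v : ℂ) = 1 := by
        obtain ⟨n, hn, hmk⟩ := exists_nat_mk_intCast_eq hp hpu' hv
        rw [coe_cubicLoc_of_not_mem hζ e huv h3v, hmk, cubicResidueSymbol_natCast_eq_one_of_residueCard_eq_sq hζ hp23 hv hN hn]
        simp
      have hϖ : varpi hζ v = -(p : 𝓞 K) := by
        refine varpi_eq_of hζ h3v (by rw [Ideal.span_singleton_neg, hvp]) ?_
        obtain ⟨m, hm⟩ : 3 ∣ p + 1 := by omega
        have hm' : (p : 𝓞 K) + 1 = 3 * (m : 𝓞 K) := by exact_mod_cast hm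
        exact Ideal.mem_span_singleton'.mpr ⟨-(m : 𝓞 K), by linear_combination hm'⟩
      rw [psiOdd_of_not_mem hζ e h3u, hJ, hC, hϖ, Int.cast_one, one_mul, one_mul]
      push_cast
      rw [map_neg, map_natCast]

end FrobeniusOdd

/-! ### §D2 Ramification at `λ` and the packaged good-at-`2` datum (universe `Type`) -/

section DatumOdd

variable {L : Type} [Field L] [NumberField L] {ξ : 𝓞 L} (hξ : IsPrimitiveRoot ξ 3) [IsCyclotomicExtension {3} ℚ L]

omit [IsCyclotomicExtension {3} ℚ L] in
/-- Congruences off `𝔭_w` from `𝔣 ∣ J · I`, `I` supported at `𝔭_w`, `a ≡ 1 (mod J)` (private copy of the `j = 1728` lemma). [folklore] -/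
private theorem sub_one_mem_pow_modulusExp_of_dvd'' {𝔣 J I : Ideal (𝓞 L)} {w : HeightOneSpectrum (𝓞 L)} (h𝔣 : 𝔣 ∣ J * I)
    (hI : ∀ v : HeightOneSpectrum (𝓞 L), v.asIdeal ∣ I → v = w) {a : 𝓞 L} (ha : a - 1 ∈ J)
    {v : HeightOneSpectrum (𝓞 L)} (hv : v ≠ w) : a - 1 ∈ v.asIdeal ^ modulusExp 𝔣 v := by
  have h1 : v.asIdeal ^ modulusExp 𝔣 v ∣ J * I := (pow_modulusExp_dvd (𝔪 := 𝔣) v).trans h𝔣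
  exact Ideal.le_of_dvd (v.prime.pow_dvd_of_dvd_mul_right _ (fun h => hv (hI v h)) h1) ha

include hξ in
/-- ★ **`ψ̃'((a)) = −S_u((a)) · a ≠ a` for a rational `a ≡ 2 (mod 3)` prime to `3u`** (`(a²/|u|) = 1`, the primary associate of `a` is `−a`).
[cite: IrelandRosen1990, Ch. 18 §6 Theorem 7, §7] -/
theorem idealPow_psiOdd_span_intCast_ne {u : ℤ} (hu : u ≠ 0) (e : L →+* ℂ) {a : ℤ} (ha3 : a % 3 = 2) (ha : IsCoprime a (3 * u)) :
    idealPow L (psiOdd hξ u e) (Ideal.span {(a : 𝓞 L)}) ≠ (a : ℂ) := by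
  haveI : IsPrincipalIdealRing (𝓞 L) := IsCyclotomicExtension.Rat.three_pid L
  have ha0 : a ≠ 0 := by rintro rfl; omega
  have ha0' : (a : 𝓞 L) ≠ 0 := by exact_mod_cast ha0
  have ha9 : IsCoprime a (9 * u) := by
    rw [show (9 : ℤ) * u = 3 * (3 * u) by ring]; exact ha.of_mul_right_left.mul_right ha
  have hcop : IsCoprime (Ideal.span {(a : 𝓞 L)}) (modulusOdd (K := L) u) := by
    rw [modulusOdd, Ideal.isCoprime_span_singleton_iff]; simpa using ha9.map (Int.castRingHom (𝓞 L))
  rw [idealPow_psiOdd_span hξ hu e ha0' hcop]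
  have hau : Int.gcd a u = 1 := Int.isCoprime_iff_gcd_eq_one.mp ha.of_mul_right_right
  have hJ : J((Ideal.absNorm (Ideal.span {(a : 𝓞 L)}) : ℤ) | u.natAbs) = 1 := by
    rw [absNorm_span_intCast, Nat.cast_pow, jacobiSym.sq_one']
    rw [Int.gcd_natCast_natCast, ← Int.gcd_eq_natAbs]; exact hau
  have h3le : modulusOdd (K := L) u ≤ Ideal.span {(3 : 𝓞 L)} := by
    rw [modulusOdd]; exact Ideal.span_singleton_le_span_singleton.mpr ⟨((3 * u : ℤ) : 𝓞 L), by push_cast; ring⟩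
  have hcop3 : IsCoprime (Ideal.span {(a : 𝓞 L)}) (Ideal.span {(3 : 𝓞 L)}) := by
    rw [Ideal.isCoprime_iff_sup_eq] at hcop ⊢; exact top_le_iff.mp (hcop ▸ sup_le_sup_left h3le _)
  have hprim : primarize (hsurj_three hξ) (a : 𝓞 L) = -(a : 𝓞 L) := by
    refine primarize_eq_of (hsurj_three hξ) (hinj_three hξ) hcop3 (Ideal.span_singleton_neg _) ?_
    obtain ⟨m, hm⟩ : (3 : ℤ) ∣ a + 1 := by omega
    refine Ideal.mem_span_singleton'.mpr ⟨-(m : 𝓞 L), ?_⟩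
    have hm' : (a : 𝓞 L) + 1 = 3 * (m : 𝓞 L) := by exact_mod_cast congrArg (Int.cast (R := 𝓞 L)) hm
    linear_combination hm'
  have hcoe : e (((a : ℤ) : 𝓞 L) : L) = (a : ℂ) := by
    rw [show (((a : ℤ) : 𝓞 L) : L) = (a : L) from map_intCast (algebraMap (𝓞 L) L) a, map_intCast]
  set S : ℂ := ((artinSymbol (cubicLoc hξ ((u : ℤ) : 𝓞 L) e) (Ideal.span {(a : 𝓞 L)}) : ℂˣ) : ℂ) with hS
  have hS3 : S ^ 3 = 1 := by rw [hS, ← Units.val_pow_eq_pow_val, artinSymbol_cubicLoc_pow_three, Units.val_one]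
  rw [hJ, hprim, Int.cast_one, one_mul]
  push_cast
  rw [map_neg, hcoe]
  intro h
  have ha0c : (a : ℂ) ≠ 0 := by exact_mod_cast ha0
  have h1 : (S + 1) * a = 0 := by linear_combination (-1 : ℂ) * h
  rcases mul_eq_zero.mp h1 with h2 | h2
  · have : S = -1 := by linear_combination h2
    rw [this] at hS3; norm_num at hS3
  · exact ha0c h2

include hξ in
/-- ★★ **`heckeOfGross ψ'` is RAMIFIED at the prime `λ` above `3`** (`u ≠ 0`): the rational witness `a = 1 + 4m²`, `|u| = 3^t m`, `3 ∤ m`.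
[cite: IrelandRosen1990, Ch. 18 §7] [cite: SilvermanATAEC1994, II Thm. 10.5] -/
theorem not_isUnramifiedAt_heckeOfGross_psiOdd_three {u : ℤ} (hu : u ≠ 0) (w₀ : InfinitePlace L) {w : HeightOneSpectrum (𝓞 L)}
    (h3w : (3 : 𝓞 L) ∈ w.asIdeal) :
    ¬ (heckeOfGross (modulusOdd_ne_bot hu) (isGrossencharakter_psiOdd_one_zero hξ hu w₀)).IsUnramifiedAt w := by
  classical
  haveI : IsTotallyComplex L := IsCyclotomicExtension.Rat.isTotallyComplex L (by norm_num : 2 < 3)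
  haveI := subsingleton_infinitePlace (K := L)
  obtain ⟨t, m, hm3, hum⟩ := Nat.exists_eq_pow_mul_and_not_dvd (Int.natAbs_ne_zero.mpr hu) 3 (by norm_num)
  set a : ℤ := 1 + 4 * (m : ℤ) ^ 2 with ha
  have ha3 : a % 3 = 2 := by
    have hm3' : (m : ℤ) % 3 = 1 ∨ (m : ℤ) % 3 = 2 := by omega
    have hsq : (m : ℤ) ^ 2 % 3 = 1 := by rcases hm3' with h | h <;> rw [pow_two, Int.mul_emod, h] <;> norm_num
    omega
  have hcop3u : IsCoprime a (3 * u) := by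
    obtain ⟨j, hj⟩ : ∃ j : ℤ, a = 3 * j + 2 := ⟨a / 3, by omega⟩
    have h3 : IsCoprime a 3 := ⟨2, -(2 * j + 1), by rw [hj]; ring⟩
    have hm' : IsCoprime a (m : ℤ) := ⟨1, -(4 * (m : ℤ)), by rw [ha]; ring⟩
    have habs : IsCoprime a (u.natAbs : ℤ) := by rw [hum]; push_cast; exact h3.pow_right.mul_right hm'
    exact h3.mul_right (habs.of_isCoprime_of_dvd_right (Int.dvd_natAbs.mpr dvd_rfl))
  have h𝔣w : modulusOdd u ≤ w.asIdeal := by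
    rw [modulusOdd_le_iff, show ((3 * u : ℤ) : 𝓞 L) = 3 * ((u : ℤ) : 𝓞 L) by push_cast; ring]
    exact w.asIdeal.mul_mem_right _ h3w
  have hcop : IsCoprime (Ideal.span {(a : 𝓞 L)}) (modulusOdd (K := L) u) := by
    have ha9 : IsCoprime a (9 * u) := by rw [show (9 : ℤ) * u = 3 * (3 * u) by ring]; exact hcop3u.of_mul_right_left.mul_right hcop3u
    rw [modulusOdd, Ideal.isCoprime_span_singleton_iff]; simpa using ha9.map (Int.castRingHom (𝓞 L))
  refine not_isUnramifiedAt_heckeOfGross_of_ne (modulusOdd_ne_bot hu) (isGrossencharakter_psiOdd_one_zero hξ hu w₀) h𝔣w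
    (a := (a : 𝓞 L)) (fun haw => ?_) hcop (fun v hv _ => ?_) ?_
  · obtain ⟨j, hj⟩ : ∃ j : ℤ, a = 3 * j + 2 := ⟨a / 3, by omega⟩
    apply w.isPrime.ne_top
    rw [Ideal.eq_top_iff_one]
    have e1 : (1 : 𝓞 L) = 3 * ((j : 𝓞 L) + 1) - (a : 𝓞 L) := by
      have : ((a : ℤ) : 𝓞 L) = ((3 * j + 2 : ℤ) : 𝓞 L) := by rw [← hj]
      rw [this]; push_cast; ring
    rw [e1]
    exact w.asIdeal.sub_mem (w.asIdeal.mul_mem_right _ h3w) haw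
  · -- `(9u) ∣ (m) · (3^{t+2})`, `a − 1 = 4m · m`
    refine sub_one_mem_pow_modulusExp_of_dvd'' (J := Ideal.span {((m : ℕ) : 𝓞 L)}) (I := Ideal.span {((3 : 𝓞 L) ^ (t + 2))})
      (w := w) ?_ (fun v' hv' => ?_) ?_ hv
    · rw [Ideal.dvd_iff_le, Ideal.span_singleton_mul_span_singleton, modulusOdd, Ideal.span_singleton_le_span_singleton]
      have hz : (9 * u : ℤ) ∣ ((m : ℕ) : ℤ) * 3 ^ (t + 2) := by
        have h1 : ((m : ℕ) : ℤ) * 3 ^ (t + 2) = 9 * (u.natAbs : ℤ) := by rw [hum]; push_cast; ring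
        rw [h1]; exact mul_dvd_mul_left 9 (Int.dvd_natAbs.mpr dvd_rfl)
      have := map_dvd (Int.castRingHom (𝓞 L)) hz
      simpa only [eq_intCast, Int.cast_mul, Int.cast_natCast, Int.cast_pow, Int.cast_ofNat] using this
    · have h3v' : (3 : 𝓞 L) ∈ v'.asIdeal := by
        rw [← Ideal.span_singleton_pow] at hv'
        exact Ideal.le_of_dvd (v'.prime.dvd_of_dvd_pow hv') (Ideal.mem_span_singleton_self _)
      exact eq_of_three_mem hξ h3v' h3w
    · exact Ideal.mem_span_singleton'.mpr ⟨((4 * m : ℕ) : 𝓞 L), by rw [ha]; push_cast; ring⟩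
  · rw [Fintype.prod_subsingleton _ w₀, zpow_one, zpow_zero, mul_one,
      show (((a : ℤ) : 𝓞 L) : L) = (a : L) from map_intCast (algebraMap (𝓞 L) L) a, map_intCast]
    exact idealPow_psiOdd_span_intCast_ne hξ hu w₀.embedding ha3 hcop3u

/-- ★★★ **The Größencharakter datum of `E^{16u} : y² = x³ + 16u`, `u ≡ 1 (mod 4)`, over `K = ℚ(ω)`** in the shape of Deuring's theorem:
`𝔣 = (9u) ≠ 0` with `𝔣 ∣ 𝔭 ↔ 3u ∈ 𝔭`, `ψ₀ = psiOdd` with `IsGrossencharakter 𝔣 (1,0) ψ₀`, `ψ₀(c•v) = conj ψ₀(v)`, the Frobenius values against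
`a_p(E^{16u})` at EVERY prime `p ∤ 3u` (including `p = 2`), ramification at `λ`, and the rational witnesses.
[cite: IrelandRosen1990, Ch. 18 §3 Theorem 4, §4 Theorem 5, §6 Theorem 7, §7] [cite: SilvermanATAEC1994, II Thm. 9.2, Thm. 10.5] -/
theorem exists_isGrossencharakter_datum_goodTwo (hξ : IsPrimitiveRoot ξ 3) {u : ℤ} (hu4 : u % 4 = 1) {c : L ≃ₐ[ℚ] L} (hc : c ≠ 1)
    (w₀ : InfinitePlace L) :
    ∃ (𝔣 : Ideal (𝓞 L)) (ψ₀ : HeightOneSpectrum (𝓞 L) → ℂ) (h𝔣 : 𝔣 ≠ ⊥)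
      (hψ₀ : IsGrossencharakter 𝔣 (fun _ => 1) (fun _ => 0) ψ₀),
      (∀ v : HeightOneSpectrum (𝓞 L), 𝔣 ≤ v.asIdeal ↔ ((3 * u : ℤ) : 𝓞 L) ∈ v.asIdeal) ∧
      (∀ v : HeightOneSpectrum (𝓞 L), ψ₀ (c • v) = conj (ψ₀ v)) ∧
      (∀ p : ℕ, p.Prime → ¬ (p : ℤ) ∣ 3 * u → ∀ v : HeightOneSpectrum (𝓞 L), (p : 𝓞 L) ∈ v.asIdeal →
        ¬ 𝔣 ≤ v.asIdeal ∧
        (c • v ≠ v → ψ₀ v + ψ₀ (c • v) = ((mordellCurve ((16 * u : ℤ) : ℚ)).LFunction p : ℂ) ∧ ψ₀ v * ψ₀ (c • v) = p) ∧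
        (c • v = v → (mordellCurve ((16 * u : ℤ) : ℚ)).LFunction p = 0 ∧ ψ₀ v = -(p : ℂ))) ∧
      (∀ w : HeightOneSpectrum (𝓞 L), (3 : 𝓞 L) ∈ w.asIdeal → ¬ (heckeOfGross h𝔣 hψ₀).IsUnramifiedAt w) ∧
      (∀ a : ℤ, a % 3 = 2 → IsCoprime a (3 * u) → idealPow L ψ₀ (Ideal.span {(a : 𝓞 L)}) ≠ (a : ℂ)) :=
  have hu : u ≠ 0 := by rintro rfl; norm_num at hu4
  ⟨modulusOdd u, psiOdd hξ u w₀.embedding, modulusOdd_ne_bot hu, isGrossencharakter_psiOdd_one_zero hξ hu w₀, modulusOdd_le_iff u,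
    fun v => psiOdd_smul_eq_conj hξ w₀.embedding hc v, fun _ hp hpu _ hv => psiOdd_frobenius hξ hu4 w₀.embedding hc hp hpu hv,
    fun _ h3w => not_isUnramifiedAt_heckeOfGross_psiOdd_three hξ hu w₀ h3w,
    fun _ ha3 ha => idealPow_psiOdd_span_intCast_ne hξ hu w₀.embedding ha3 ha⟩

/-- ★★ **The algebraic Hecke character of `ℚ(ω)` attached to `E^{16u}`, `u ≡ 1 (4)`** (`heckeOfGross psiOdd`): infinity type `(1, 0)`, ramified at
`λ`, and at every `v ∣ p ∤ 3u` unramified with Deuring's values against `a_p(E^{16u})` — clauses (i), (ii), (iv) on the good-at-`2` class.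
[cite: IrelandRosen1990, Ch. 18 §7] [cite: SilvermanATAEC1994, II Thm. 9.2 (a), Thm. 10.5 (b)] [cite: NeukirchANT1999, Ch. VII §6 Cor. (6.14)] -/
theorem exists_heckeCharacter_psiOdd (hξ : IsPrimitiveRoot ξ 3) {u : ℤ} (hu4 : u % 4 = 1) {c : L ≃ₐ[ℚ] L} (hc : c ≠ 1)
    (w₀ : InfinitePlace L) :
    ∃ ψ : HeckeCharacter L, ψ.HasInfinityType (fun _ => 1) (fun _ => 0) ∧
      (∀ w : HeightOneSpectrum (𝓞 L), (3 : 𝓞 L) ∈ w.asIdeal → ¬ ψ.IsUnramifiedAt w) ∧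
      ∀ p : ℕ, p.Prime → ¬ (p : ℤ) ∣ 3 * u → ∀ v : HeightOneSpectrum (𝓞 L), (p : 𝓞 L) ∈ v.asIdeal →
        ψ.IsUnramifiedAt v ∧ ψ.valueAtUniformizer (c • v) = conj (ψ.valueAtUniformizer v) ∧
        (c • v ≠ v → ψ.valueAtUniformizer v + ψ.valueAtUniformizer (c • v) = ((mordellCurve ((16 * u : ℤ) : ℚ)).LFunction p : ℂ) ∧
          ψ.valueAtUniformizer v * ψ.valueAtUniformizer (c • v) = p) ∧
        (c • v = v → (mordellCurve ((16 * u : ℤ) : ℚ)).LFunction p = 0 ∧ ψ.valueAtUniformizer v = -(p : ℂ)) := by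
  have hu : u ≠ 0 := by rintro rfl; norm_num at hu4
  have h𝔣 : modulusOdd (K := L) u ≠ ⊥ := modulusOdd_ne_bot hu
  have hψ := isGrossencharakter_psiOdd_one_zero hξ hu w₀
  refine ⟨heckeOfGross h𝔣 hψ, heckeOfGross_hasInfinityType h𝔣 hψ,
    fun w h3w => not_isUnramifiedAt_heckeOfGross_psiOdd_three hξ hu w₀ h3w, fun p hp hpu v hv => ?_⟩
  obtain ⟨hv', hsplit, hinert⟩ := psiOdd_frobenius hξ hu4 w₀.embedding hc hp hpu hv
  have hcv : (p : 𝓞 L) ∈ (c • v).asIdeal := by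
    have h := (intCast_mem_smul_iff c v (p : ℤ)).mpr (by rwa [Int.cast_natCast])
    rwa [Int.cast_natCast] at h
  have hcv' : ¬ modulusOdd u ≤ (c • v).asIdeal := (psiOdd_frobenius hξ hu4 w₀.embedding hc hp hpu hcv).1
  rw [heckeOfGross_valueAtUniformizer h𝔣 hψ hv', heckeOfGross_valueAtUniformizer h𝔣 hψ hcv']
  exact ⟨heckeOfGross_isUnramifiedAt h𝔣 hψ hv', psiOdd_smul_eq_conj hξ w₀.embedding hc v, hsplit, hinert⟩

end DatumOdd

end Literature.NumberTheory.EllipticCurves.SexticTwist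

end
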